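import Literature.Barriers.CriticalPhenomena.GaussianDominationRouteNoble

/-!
# Sanity lemmas for the NoBLE index set `nobleTriple` (pub-lace REVIEW-RUNBOOK, card `nobleTriple`)

Review evidence only (ops-runbook sanity registry `registry/pub-lace.json`); no new definitions.
`nobleTriple d : Fin 6 → ℕ × ℕ × Set (Site d)` enumerates the index set
`𝒮 = {(0,0,𝒳), (1,0,𝒳), (1,1,𝒳), (1,2,𝒳), (1,3,𝒳), (1,6,{0})}` of Fitzner–van der Hofstad 2017, (2.23)
(`Literature/Barriers/CriticalPhenomena/GaussianDominationRouteNoble.lean`).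

The review-relevant fact made explicit here: the LAST triple is `(1, 6, {0})` — the tree follows the
percolation paper FvdH 2017 (2.23); the general NoBLE paper [FitHof13b, §2.1] prints `(1, 4, {0})` there
(the definition's docstring records the discrepancy). The first five triples carry the set `𝒳 = {x : 1 < ‖x‖₂}`.
-/

namespace Summit.CriticalPhenomena.LaceExpansionHighD.Runbook

open Literature.Barriers.CriticalPhenomena Literature.Probability.LatticeModels

variable (d : ℕ)

/-- The last index triple is `(n, l, S) = (1, 6, {0})` (FvdH 2017 (2.23); NOT the `(1, 4, {0})` of
[FitHof13b, §2.1]). -/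
theorem nobleTriple_last : nobleTriple d 5 = (1, 6, {0}) := rfl

/-- Its `l`-component is `6`. -/
theorem nobleTriple_last_l : (nobleTriple d 5).2.1 = 6 := rfl

/-- The first triple is `(0, 0, 𝒳)`. -/
theorem nobleTriple_zero : nobleTriple d 0 = (0, 0, calX d) := rfl

/-- Every triple but the first has `n = 1`; the first has `n = 0`. -/
theorem nobleTriple_n (i : Fin 6) : (nobleTriple d i).1 = if i = 0 then 0 else 1 := by
  fin_cases i <;> rfl

/-- The six `(n, l)` pairs `(0,0), (1,0), (1,1), (1,2), (1,3), (1,6)` are pairwise distinct (the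
enumeration by `Fin 6` has no repeated index). -/
theorem nobleTriple_nl_injective :
    Function.Injective fun i : Fin 6 => ((nobleTriple d i).1, (nobleTriple d i).2.1) := by
  intro i j h
  fin_cases i <;> fin_cases j <;> simp_all [nobleTriple]

/-- The origin is NOT in `𝒳 = {x : 1 < ‖x‖₂}` (so the last triple's set `{0}` is disjoint from the
others' set `𝒳`). -/
theorem zero_not_mem_calX : (0 : Site d) ∉ calX d := by
  simp [calX, euclidNorm, Set.mem_setOf_eq]

end Summit.CriticalPhenomena.LaceExpansionHighD.Runbook
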